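import Summits.KontsevichZagierPeriods.KontsevichZagierPeriods.Theorems.SoloBlindCells
import HarnessLib

/-!
# The Kontsevich–Zagier conjecture in dimension `≤ 1`, IV: the cell class

`IsCellSum z` says that the formal combination `z` is congruent modulo `KZ.relations` to a
STANDARD CELL SUM `[K(α)] + Σ_i [L(c_i; λ_i)] + Σ_k [A(d_k; τ_k)]` with `λ_i > 1`, `τ_k > 0` and
all parameters real algebraic.  The class of such `z` contains `relations`, is closed under
`+`, `−` and finite sums (negation = negating the coefficients), and — by the moves of part I —
contains every point cell `K(α)`, every logarithmic segment `L(c; a, b)` (`0 < a`, dilate to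
`[1, b/a]`) and every arctangent segment `A(d; a, b)` (split at `0`, reflect, Möbius move to
`[0, ·]`).  This is the target of the normal-form algorithm (parts V–VI) and the source of the
injectivity theorem (part III).
-/

noncomputable section

open MeasureTheory Set Filter Finset
open scoped BigOperators Topology

namespace Summit.KontsevichZagierPeriods.KontsevichZagierPeriods.Theorems

open Literature.NumberTheory.Transcendental
open Literature.NumberTheory.Transcendental.KZ

namespace SoloBlind

/-- The standard cell sum with data `(α; c, λ; d, τ)`. -/
def cellSum {ιL ιA : Type} [Fintype ιL] [Fintype ιA] (α : ℝ) (hα : IsAlgebraic ℚ α)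
    (c l : ιL → ℝ) (hc : ∀ i, IsAlgebraic ℚ (c i)) (hl : ∀ i, IsAlgebraic ℚ (l i))
    (d τ : ιA → ℝ) (hd : ∀ k, IsAlgebraic ℚ (d k)) (hτ : ∀ k, IsAlgebraic ℚ (τ k)) : FormalRep :=
  of (constCell α hα) + ∑ i, of (logCell (c i) (l i) (hc i) (hl i)) +
    ∑ k, of (atanCell (d k) (τ k) (hd k) (hτ k))

/-- `z` is congruent modulo `KZ.relations` to a standard cell sum with `λ_i > 1`, `τ_k > 0`. -/
def IsCellSum (z : FormalRep) : Prop :=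
  ∃ (ιL ιA : Type) (_ : Fintype ιL) (_ : Fintype ιA) (α : ℝ) (hα : IsAlgebraic ℚ α)
    (c l : ιL → ℝ) (hc : ∀ i, IsAlgebraic ℚ (c i)) (hl : ∀ i, IsAlgebraic ℚ (l i))
    (d τ : ιA → ℝ) (hd : ∀ k, IsAlgebraic ℚ (d k)) (hτ : ∀ k, IsAlgebraic ℚ (τ k)),
    (∀ i, 1 < l i) ∧ (∀ k, 0 < τ k) ∧ z - cellSum α hα c l hc hl d τ hd hτ ∈ relations

/-! ## Closure properties -/

/-- The cell class is invariant under congruence modulo `relations`. -/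
theorem IsCellSum.of_sub_mem {z z' : FormalRep} (hz' : IsCellSum z') (h : z - z' ∈ relations) :
    IsCellSum z := by
  obtain ⟨ιL, ιA, _, _, α, hα, c, l, hc, hl, d, τ, hd, hτ, h1, h0, hrel⟩ := hz'
  refine ⟨ιL, ιA, inferInstance, inferInstance, α, hα, c, l, hc, hl, d, τ, hd, hτ, h1, h0, ?_⟩
  have := relations.add_mem h hrel
  convert this using 1
  abel

/-- Point cells are cell sums. -/
theorem isCellSum_constCell (α : ℝ) (hα : IsAlgebraic ℚ α) : IsCellSum (of (constCell α hα)) := by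
  refine ⟨Fin 0, Fin 0, inferInstance, inferInstance, α, hα, Fin.elim0, Fin.elim0,
    fun i => i.elim0, fun i => i.elim0, Fin.elim0, Fin.elim0, fun k => k.elim0, fun k => k.elim0,
    fun i => i.elim0, fun k => k.elim0, ?_⟩
  simp [cellSum, relations.zero_mem]

/-- Members of `relations` are cell sums. -/
theorem isCellSum_of_mem_relations {z : FormalRep} (hz : z ∈ relations) : IsCellSum z := by
  refine (isCellSum_constCell 0 isAlgebraic_zero).of_sub_mem ?_
  exact relations.sub_mem hz constCell_zero

/-- `0` is a cell sum. -/
theorem isCellSum_zero : IsCellSum 0 := isCellSum_of_mem_relations relations.zero_mem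

/-- The cell class is closed under addition (concatenate the data, add the constants). -/
theorem IsCellSum.add {z₁ z₂ : FormalRep} (h₁ : IsCellSum z₁) (h₂ : IsCellSum z₂) :
    IsCellSum (z₁ + z₂) := by
  obtain ⟨ιL₁, ιA₁, _, _, α₁, hα₁, c₁, l₁, hc₁, hl₁, d₁, τ₁, hd₁, hτ₁, h1₁, h0₁, hr₁⟩ := h₁
  obtain ⟨ιL₂, ιA₂, _, _, α₂, hα₂, c₂, l₂, hc₂, hl₂, d₂, τ₂, hd₂, hτ₂, h1₂, h0₂, hr₂⟩ := h₂
  refine ⟨ιL₁ ⊕ ιL₂, ιA₁ ⊕ ιA₂, inferInstance, inferInstance, α₁ + α₂, hα₁.add hα₂,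
    Sum.elim c₁ c₂, Sum.elim l₁ l₂, fun i => i.rec hc₁ hc₂, fun i => i.rec hl₁ hl₂,
    Sum.elim d₁ d₂, Sum.elim τ₁ τ₂, fun k => k.rec hd₁ hd₂, fun k => k.rec hτ₁ hτ₂,
    fun i => i.rec h1₁ h1₂, fun k => k.rec h0₁ h0₂, ?_⟩
  have hK := constCell_add (hα := hα₁) (hβ := hα₂) (hαβ := hα₁.add hα₂)
  have := relations.sub_mem (relations.add_mem hr₁ hr₂) hK
  convert this using 1
  simp only [cellSum, Fintype.sum_sum_type, Sum.elim_inl, Sum.elim_inr]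
  abel

/-- The cell class is closed under negation (negate the coefficients). -/
theorem IsCellSum.neg {z : FormalRep} (h : IsCellSum z) : IsCellSum (-z) := by
  obtain ⟨ιL, ιA, _, _, α, hα, c, l, hc, hl, d, τ, hd, hτ, h1, h0, hrel⟩ := h
  refine ⟨ιL, ιA, inferInstance, inferInstance, -α, hα.neg, fun i => -c i, l,
    fun i => (hc i).neg, hl, fun k => -d k, τ, fun k => (hd k).neg, hτ, h1, h0, ?_⟩
  have hK := constCell_neg (hα := hα) (hα' := hα.neg)
  have hL : ∑ i, of (logCell (c i) (l i) (hc i) (hl i)) +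
      ∑ i, of (logCell (-c i) (l i) ((hc i).neg) (hl i)) ∈ relations := by
    rw [← Finset.sum_add_distrib]
    exact sum_mem fun i _ => logSeg_coeff_neg
  have hA : ∑ k, of (atanCell (d k) (τ k) (hd k) (hτ k)) +
      ∑ k, of (atanCell (-d k) (τ k) ((hd k).neg) (hτ k)) ∈ relations := by
    rw [← Finset.sum_add_distrib]
    exact sum_mem fun k _ => atanSeg_coeff_neg
  have := relations.sub_mem (relations.neg_mem hrel)
    (relations.add_mem (relations.add_mem hK hL) hA)
  simp only [cellSum] at this ⊢
  convert this using 1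
  abel

/-- The cell class is closed under subtraction. -/
theorem IsCellSum.sub {z₁ z₂ : FormalRep} (h₁ : IsCellSum z₁) (h₂ : IsCellSum z₂) :
    IsCellSum (z₁ - z₂) := by
  rw [sub_eq_add_neg]
  exact h₁.add h₂.neg

/-- The cell class is closed under finite sums. -/
theorem IsCellSum.sum {κ : Type*} (s : Finset κ) (f : κ → FormalRep)
    (h : ∀ j ∈ s, IsCellSum (f j)) : IsCellSum (∑ j ∈ s, f j) :=
  Finset.sum_induction f IsCellSum (fun _ _ ha hb => ha.add hb) isCellSum_zero h

/-! ## Segments are cell sums -/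

/-- A logarithmic cell `L(c; λ)` with `λ ≥ 1` is a cell sum. -/
theorem isCellSum_logCell (c l : ℝ) (hc : IsAlgebraic ℚ c) (hl : IsAlgebraic ℚ l) (h1 : 1 ≤ l) :
    IsCellSum (of (logCell c l hc hl)) := by
  rcases h1.lt_or_eq with h1 | h1
  · refine ⟨Fin 1, Fin 0, inferInstance, inferInstance, 0, isAlgebraic_zero, fun _ => c, fun _ => l,
      fun _ => hc, fun _ => hl, Fin.elim0, Fin.elim0, fun k => k.elim0, fun k => k.elim0,
      fun _ => h1, fun k => k.elim0, ?_⟩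
    have := relations.neg_mem (constCell_zero (h0 := isAlgebraic_zero))
    convert this using 1
    simp [cellSum]
  · exact isCellSum_of_mem_relations (logSeg_null h1.symm.le)

/-- A logarithmic segment `L(c; a, b)` with `0 < a` is a cell sum (dilate by `1/a`). -/
theorem isCellSum_logSeg (c a b : ℝ) (hc : IsAlgebraic ℚ c) (ha : IsAlgebraic ℚ a)
    (hb : IsAlgebraic ℚ b) (h0 : 0 < a) : IsCellSum (of (logSeg c a b hc ha hb h0)) := by
  by_cases hba : b ≤ a
  · exact isCellSum_of_mem_relations (logSeg_null hba)
  · have hab : a < b := not_le.mp hba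
    have hl : IsAlgebraic ℚ (b / a) := by
      rw [div_eq_mul_inv]; exact hb.mul ha.inv
    have h1 : 1 ≤ b / a := by rw [le_div_iff₀ h0]; linarith
    refine (isCellSum_logCell c (b / a) hc hl h1).of_sub_mem ?_
    rw [logCell_eq]
    exact logSeg_dilate (s := a⁻¹) ha.inv (inv_pos.mpr h0) (inv_mul_cancel₀ h0.ne').symm
      (div_eq_inv_mul b a)

/-- An arctangent cell `A(d; τ)` with `τ ≥ 0` is a cell sum. -/
theorem isCellSum_atanCell (d τ : ℝ) (hd : IsAlgebraic ℚ d) (hτ : IsAlgebraic ℚ τ) (h0 : 0 ≤ τ) :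
    IsCellSum (of (atanCell d τ hd hτ)) := by
  rcases h0.lt_or_eq with h0 | h0
  · refine ⟨Fin 0, Fin 1, inferInstance, inferInstance, 0, isAlgebraic_zero, Fin.elim0, Fin.elim0,
      fun i => i.elim0, fun i => i.elim0, fun _ => d, fun _ => τ, fun _ => hd, fun _ => hτ,
      fun i => i.elim0, fun _ => h0, ?_⟩
    have := relations.neg_mem (constCell_zero (h0 := isAlgebraic_zero))
    convert this using 1
    simp [cellSum]
  · exact isCellSum_of_mem_relations (atanSeg_null h0.symm.le)

/-- An arctangent segment `A(d; a, b)` with `0 ≤ a` is a cell sum (Möbius move to `[0, ψ_a(b)]`). -/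
theorem isCellSum_atanSeg_of_nonneg (d a b : ℝ) (hd : IsAlgebraic ℚ d) (ha : IsAlgebraic ℚ a)
    (hb : IsAlgebraic ℚ b) (h0 : 0 ≤ a) : IsCellSum (of (atanSeg d a b hd ha hb)) := by
  by_cases hba : b ≤ a
  · exact isCellSum_of_mem_relations (atanSeg_null hba)
  · have hab : a < b := not_le.mp hba
    have hρ' : IsAlgebraic ℚ (moebiusInv a b) := by
      unfold moebiusInv
      rw [div_eq_mul_inv]
      exact (hb.sub ha).mul (isAlgebraic_one.add (ha.mul hb)).inv
    refine (isCellSum_atanCell d (moebiusInv a b) hd hρ' (moebiusInv_nonneg h0 hab.le)).of_sub_mem ?_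
    have h := atanSeg_moebius (d := d) (hd := hd) h0 hab.le rfl (hσa := ha) (hρa := hb)
      (h0 := isAlgebraic_zero) (hρ'a := hρ')
    rw [atanCell_eq]
    have := relations.neg_mem h
    convert this using 1
    abel

/-- Every arctangent segment `A(d; a, b)` is a cell sum (split at `0`, reflect the negative
part). -/
theorem isCellSum_atanSeg (d a b : ℝ) (hd : IsAlgebraic ℚ d) (ha : IsAlgebraic ℚ a)
    (hb : IsAlgebraic ℚ b) : IsCellSum (of (atanSeg d a b hd ha hb)) := by
  by_cases h0a : 0 ≤ a
  · exact isCellSum_atanSeg_of_nonneg d a b hd ha hb h0a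
  have ha0 : a < 0 := not_le.mp h0a
  by_cases hb0 : b ≤ 0
  · -- reflect: `A(d; a, b) ≡ A(d; −b, −a)` with `0 ≤ −b`
    refine (isCellSum_atanSeg_of_nonneg d (-b) (-a) hd hb.neg ha.neg (by linarith)).of_sub_mem ?_
    exact atanSeg_reflect
  · have h0b : 0 < b := not_le.mp hb0
    -- split at `0`
    have hsplit := atanSeg_split (d := d) (a := a) (b := b) (hd := hd) (ha := ha) (hb := hb)
      ha0.le h0b.le (hl := isAlgebraic_zero)
    have hleft : IsCellSum (of (atanSeg d a 0 hd ha isAlgebraic_zero)) := by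
      refine (isCellSum_atanSeg_of_nonneg d (-0) (-a) hd isAlgebraic_zero.neg ha.neg
        (by simp)).of_sub_mem ?_
      exact atanSeg_reflect
    have hright : IsCellSum (of (atanSeg d 0 b hd isAlgebraic_zero hb)) :=
      isCellSum_atanSeg_of_nonneg d 0 b hd isAlgebraic_zero hb le_rfl
    refine (hleft.add hright).of_sub_mem ?_
    convert hsplit using 1
    abel

end SoloBlind

end Summit.KontsevichZagierPeriods.KontsevichZagierPeriods.Theorems
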